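import Literature.Computability.AlgebraicComplexity.YoungSubgroupCharacterSum
import Literature.RepresentationTheory.FiniteGroups.SymmetricGroupColumnOrthogonality
import Literature.RepresentationTheory.GeneralLinear.PlethysmWordModel
import HarnessLib

/-!
# The restriction of `χ^λ` to a Young subgroup, summed over a product set

Topic `Literature/Computability/AlgebraicComplexity` (val-lit cell, board U1 = `IK2020_prop_10_1`,
brick **B3** of part P2; continues `YoungSubgroupCharacterSum.lean` (B2) with the column
orthogonality bricks of `SymmetricGroupColumnOrthogonality.lean` (B3a–c)). Theorems only.

Fulton–Harris §4.3 (4.41)–(4.43) / Ex. 4.44: `Res^{𝔖_n}_{𝔖_{n₁}×⋯×𝔖_{n_d}} χ^λ =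
∑_{μ•} c^λ_{μ¹…μ^d} χ^{μ¹} ⊠ ⋯ ⊠ χ^{μ^d}`. This file proves the consequence that the route to
IK 2020 Prop. 10.1 consumes — the identity **summed over a product set** `K₁ × ⋯ × K_d`,
`K_i ⊆ 𝔖_{n_i}` — without developing the character theory of the product group:

  `∑_{μ•} c^λ_{μ•} ∏_i (∑_{κ ∈ K_i} χ^{μ^i}(κ)) = ∑_{κ ∈ ∏ K_i} χ^λ(κ₁ ⋯ κ_d)`
  (`IK2020.sum_multiLRCoeff_mul_prod_sum_eq`, over `ℂ`, `ℓ(λ) ≤ N`).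

Proof: B2 (`(∏ n_i!) c^λ_{μ•} = ∑_y (∏ χ^{μ^i}(y_i)) χ^λ(y₁⋯y_d)`), exchange of `∑_{μ•} ∏_i` with
`∏_i ∑_{μ^i}`, column orthogonality in each `𝔖_{n_i}` (`sum_spechtCharacter_mul_spechtCharacter`:
`∑_μ χ^μ(y_i) ∑_{κ∈K_i} χ^μ(κ) = n_i! |K_i ∩ cl(y_i)|/|cl(y_i)|`), componentwise conjugacy in the
product (`card_filter_isConj_piFinset`) and the class-by-class count of
`∑_{κ ∈ ∏K_i} χ^λ(κ₁⋯κ_d)` (`IsClassFun.sum_eq_sum_mul_card_inter_class_div`).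

Honest framing: finite-group character bookkeeping; nothing here bears on VP versus VNP, which
is NOT proved.

## References

* [FultonHarrisGTM129] W. Fulton, J. Harris, *Representation Theory*, GTM 129, §4.3
  (4.41)–(4.43), Ex. 4.44.
* [SerreLinearRepresentations1977] J.-P. Serre, *Linear Representations of Finite Groups*, §2.5
  Prop. 7, §3.2, §7.2.
* [IkenmeyerKandasamy2019] C. Ikenmeyer, U. Kandasamy, arXiv:1911.03990, §3, §10.
-/

noncomputable section

open scoped BigOperators

namespace Literature.Computability.AlgebraicComplexity

open _root_.Literature.NumberTheory.DiophantineGeometry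
open _root_.Literature.RepresentationTheory.FiniteGroups (IsClassFun
  sum_spechtCharacter_mul_sum_eq card_filter_isConj_piFinset card_filter_isConj_ne_zero)

variable {N d : ℕ} {n : Fin d → ℕ}

/-- `∏_i ι_i(y_i) = y` in a direct product (list product in the order of `Fin d`). [folklore] -/
private theorem prod_ofFn_mulSingle' {H : Fin d → Type*} [∀ i, Group (H i)]
    (y : (i : Fin d) → H i) : (List.ofFn fun i => Pi.mulSingle i (y i)).prod = y := by
  classical
  have h1 : (List.ofFn fun i => Pi.mulSingle (M := H) i (y i)).prod =
      (List.finRange d).toFinset.noncommProd (fun i => Pi.mulSingle (M := H) i (y i))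
        (fun i _ j _ _ => Pi.mulSingle_apply_commute y i j) := by
    rw [Finset.noncommProd_toFinset _ _ _ (List.nodup_finRange d), List.ofFn_eq_map]
  rw [h1]
  have h2 := Finset.noncommProd_mulSingle (M := H) y
  convert h2 using 2
  exact List.toFinset_finRange d

/-- The product of the block permutations is the Young-subgroup embedding (a homomorphism)
applied to the tuple. [folklore] -/
private theorem prod_ofFn_blockPermHom' (y : (i : Fin d) → Equiv.Perm (Fin (n i))) :
    (List.ofFn fun i => IK2020.blockPermHom n i (y i)).prod =
      ((Equiv.permCongrHom (finSigmaFinEquiv (n := n))).toMonoidHom.comp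
        (Equiv.Perm.sigmaCongrRightHom fun j => Fin (n j))) y := by
  classical
  have h : (fun i => IK2020.blockPermHom n i (y i)) =
      ⇑((Equiv.permCongrHom (finSigmaFinEquiv (n := n))).toMonoidHom.comp
        (Equiv.Perm.sigmaCongrRightHom fun j => Fin (n j))) ∘ fun i => Pi.mulSingle i (y i) := by
    funext i
    rw [Function.comp_apply, IK2020.blockPermHom, MonoidHom.comp_apply, MonoidHom.mulSingle_apply]
  rw [h, ← List.map_ofFn, ← map_list_prod, prod_ofFn_mulSingle']

/-- `y ↦ χ^λ(y₁ ⋯ y_d)` is a class function on `∏_i 𝔖_{n_i}` (the embedding is a homomorphism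
and `χ^λ` is a class function on `𝔖_n`). [folklore] -/
private theorem isClassFun_spechtCharacter_prod_blockPermHom (lam : Nat.Partition (∑ j, n j)) :
    IsClassFun (G := (i : Fin d) → Equiv.Perm (Fin (n i)))
      fun y => spechtCharacter ℂ lam (List.ofFn fun i => IK2020.blockPermHom n i (y i)).prod := by
  intro s t
  simp only [prod_ofFn_blockPermHom', map_mul, map_inv, spechtCharacter_conj]

/-- **`∑_{μ•} c^λ_{μ•} ∏_i (∑_{κ ∈ K_i} χ^{μ^i}(κ)) = ∑_{κ ∈ ∏_i K_i} χ^λ(κ₁ ⋯ κ_d)`** — the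
Littlewood–Richardson restriction formula `Res χ^λ = ∑_{μ•} c^λ_{μ•} ⊠_i χ^{μ^i}`
(Fulton–Harris (4.41)–(4.43), Ex. 4.44) summed over a product set `∏_i K_i`, `K_i ⊆ 𝔖_{n_i}`
(`ℓ(λ) ≤ N`; `c^λ_{μ•} = IK2020.multiLRCoeff ℂ N μ• λ`, `κ₁ ⋯ κ_d` the product of the block
permutations). Obtained from B2 (`IK2020.prod_factorial_mul_multiLRCoeff_eq_sum`) by column
orthogonality in each block, without the character theory of the product group.
[cite: FultonHarrisGTM129, §4.3 (4.41)–(4.43)] [cite: IkenmeyerKandasamy2019, §10 (proof of Prop. 10.1)] -/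
theorem IK2020.sum_multiLRCoeff_mul_prod_sum_eq (K : (i : Fin d) → Finset (Equiv.Perm (Fin (n i))))
    (lam : Nat.Partition (∑ j, n j)) (hlam : lam.parts.card ≤ N) :
    ∑ μ : (i : Fin d) → Nat.Partition (n i),
        (IK2020.multiLRCoeff ℂ N μ lam : ℂ) * ∏ i, ∑ κ ∈ K i, spechtCharacter ℂ (μ i) κ =
      ∑ κ ∈ Fintype.piFinset K,
        spechtCharacter ℂ lam (List.ofFn fun i => IK2020.blockPermHom n i (κ i)).prod := by
  set Y : ℂ := ∏ i, (((n i).factorial : ℕ) : ℂ) with hY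
  have hY0 : Y ≠ 0 :=
    Finset.prod_ne_zero_iff.mpr fun i _ => Nat.cast_ne_zero.mpr (Nat.factorial_ne_zero _)
  apply mul_left_cancel₀ hY0
  -- Step 1 (B2): `Y · c^λ_{μ•} = ∑_y (∏ χ^{μ^i}(y_i)) χ^λ(y₁⋯y_d)`
  have h1 : Y * ∑ μ : (i : Fin d) → Nat.Partition (n i),
      (IK2020.multiLRCoeff ℂ N μ lam : ℂ) * ∏ i, ∑ κ ∈ K i, spechtCharacter ℂ (μ i) κ =
      ∑ μ : (i : Fin d) → Nat.Partition (n i), ∑ y : (i : Fin d) → Equiv.Perm (Fin (n i)),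
        spechtCharacter ℂ lam (List.ofFn fun i => IK2020.blockPermHom n i (y i)).prod *
          ∏ i, (spechtCharacter ℂ (μ i) (y i) * ∑ κ ∈ K i, spechtCharacter ℂ (μ i) κ) := by
    rw [Finset.mul_sum]
    refine Finset.sum_congr rfl fun μ _ => ?_
    rw [← mul_assoc, hY, IK2020.prod_factorial_mul_multiLRCoeff_eq_sum ℂ μ lam hlam,
      Finset.sum_mul]
    refine Finset.sum_congr rfl fun y _ => ?_
    rw [Finset.prod_mul_distrib]
    ring
  -- Step 2 (class-by-class count on the right; conjugacy in the product is componentwise)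
  have h3 := (isClassFun_spechtCharacter_prod_blockPermHom lam).sum_eq_sum_mul_card_inter_class_div
    (Fintype.piFinset K)
  rw [h1, Finset.sum_comm, h3, Finset.mul_sum]
  refine Finset.sum_congr rfl fun y _ => ?_
  -- Step 3: exchange `∑_{μ•} ∏_i` with `∏_i ∑_{μ^i}` and use column orthogonality per block
  rw [← Finset.mul_sum, ← Fintype.piFinset_univ, ← Finset.prod_univ_sum (fun _ => Finset.univ)
    (fun i (μ : Nat.Partition (n i)) =>
      spechtCharacter ℂ μ (y i) * ∑ κ ∈ K i, spechtCharacter ℂ μ κ)]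
  simp_rw [sum_spechtCharacter_mul_sum_eq]
  rw [card_filter_isConj_piFinset, Nat.cast_prod, Finset.prod_div_distrib,
    Finset.prod_mul_distrib, ← hY]
  -- the class of `y` in the product: `Finset.univ = Fintype.piFinset fun _ => univ`
  have hcl := card_filter_isConj_piFinset y fun i => (Finset.univ : Finset (Equiv.Perm (Fin (n i))))
  rw [Fintype.piFinset_univ] at hcl
  rw [hcl, Nat.cast_prod, mul_div_assoc, mul_div_assoc]
  ring

/-! ### The per-block count: `|𝔖_a ≀ 𝔖_b| · a_μ(a,b) = ∑_{τ ∈ 𝔖_a ≀ 𝔖_b} χ^μ(τ)` -/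

section PerBlock

open _root_.Literature.RepresentationTheory.GeneralLinear

/-- **The plethysm coefficient as a character average over the wreath product**:
`|𝔖_a ≀ 𝔖_b| · a_μ(a, b) = ∑_{τ ∈ 𝔖_a ≀ 𝔖_b} χ^μ(τ)` for `μ ⊢ a·b` with `ℓ(μ) ≤ N`, `b ≠ 0`
(`a_μ(a,b) = plethysmCoeffOfPartition k N b μ` = the multiplicity of `μ^*` in `k[Sym^b(k^N)]_a`;
the tree's `plethysmCoeffOfPartition_eq_finrank_wreathHW` with `card_mul_finrank_wreathHW` for
the trivial twist) — the factor `a_{μ^i}(ρ̂_i, iD)` of IK's `b(λ,ϱ,D,d)` (Prop. 4.1 / Prop. 10.1).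
[cite: IkenmeyerKandasamy2019, Prop. 10.1 (proof, §10)] -/
theorem card_blockPerms_mul_plethysmCoeffOfPartition {a b : ℕ} (hb : b ≠ 0)
    (μ : Nat.Partition (a * b)) (hμ : μ.parts.card ≤ N) :
    (Nat.card ↥(blockPerms a b) : ℂ) * (plethysmCoeffOfPartition ℂ N b μ : ℂ) =
      ∑ τ : ↥(blockPerms a b), spechtCharacter ℂ μ (τ : Equiv.Perm (Fin (a * b))) := by
  rw [plethysmCoeffOfPartition_eq_finrank_wreathHW (k := ℂ) (N := N) hb μ hμ,
    card_mul_finrank_wreathHW (k := ℂ) (N := N) (1 : ↥(blockPerms a b) →* ℤˣ) μ hμ]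
  refine Finset.sum_congr rfl fun τ _ => ?_
  rw [MonoidHom.one_apply, Units.val_one, Int.cast_one, one_mul]

end PerBlock

/-! ### Bookkeeping casts for `bCoeff`'s index types

`IK2020.bCoeff` types the block partitions as `μ^i ⊢ D·(i+1)·ρ̂_{i+1}` while the wreath products
`blockPerms a b ≤ 𝔖_{a·b}` and `plethysmCoeffOfPartition k N b μ` (`μ ⊢ a·b`) want the size
written as `ρ̂_{i+1}·((i+1)D)`: the lemmas below move Specht characters, plethysm coefficients and
multi-Littlewood–Richardson coefficients across such a propositional equality of sizes. -/

section Casts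

variable (k : Type*) [Field k]

/-- Specht characters across a relabelling `Fin a ≃ Fin b` of equal sizes, for partitions with
the same parts (bookkeeping for the block sizes `D·i·ρ̂_i = ρ̂_i·(iD)` of IK's `b(λ,ϱ,D,d)`).
[cite: IkenmeyerKandasamy2019, Prop. 10.1 (proof, §10)] -/
theorem spechtCharacter_permCongr_finCongr {a b : ℕ} (h : a = b) (μ : Nat.Partition a)
    (μ' : Nat.Partition b) (hμ : μ'.parts = μ.parts) (τ : Equiv.Perm (Fin a)) :
    spechtCharacter k μ' ((finCongr h).permCongr τ) = spechtCharacter k μ τ := by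
  subst h
  obtain rfl : μ' = μ := Nat.Partition.ext hμ
  congr 1

/-- Plethysm coefficients depend only on the parts of the partition (same bookkeeping).
[cite: IkenmeyerKandasamy2019, Prop. 10.1 (proof, §10)] -/
theorem plethysmCoeffOfPartition_congr {a b : ℕ} (h : a = b) (μ : Nat.Partition a)
    (μ' : Nat.Partition b) (hμ : μ'.parts = μ.parts) (N m : ℕ) :
    plethysmCoeffOfPartition k N m μ' = plethysmCoeffOfPartition k N m μ := by
  subst h
  obtain rfl : μ' = μ := Nat.Partition.ext hμ
  rfl

/-- Multi-Littlewood–Richardson coefficients across equal block sizes, for families of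
partitions with the same parts (same bookkeeping). [cite: IkenmeyerKandasamy2019, §3] -/
theorem IK2020.multiLRCoeff_congr {n n' : Fin d → ℕ} (h : n = n')
    (μ : (i : Fin d) → Nat.Partition (n i)) (μ' : (i : Fin d) → Nat.Partition (n' i))
    (hμ : ∀ i, (μ' i).parts = (μ i).parts) {s : ℕ} (lam : Nat.Partition s) :
    IK2020.multiLRCoeff k N μ' lam = IK2020.multiLRCoeff k N μ lam := by
  subst h
  obtain rfl : μ' = μ := funext fun i => Nat.Partition.ext (hμ i)
  rfl

end Casts

end Literature.Computability.AlgebraicComplexity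

end
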